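/-
Copyright: public-domain mathematics; typed transcription for the H21 Literature library (cell lit-balaban,
reader/typer seat r02 gen 6 = literature-prover-lit-balaban-r02-g6-0; fold owner of block B2).

statement-level skeleton of published theorems with citation tags; proofs where landed; nothing here is a claim about the Yang–Mills mass gap

# Bałaban, *(Higgs)₂,₃ quantum fields in a finite volume. II. An upper bound*, Commun. Math. Phys. **86** (1982) 555–594
# — (2.94) p. 576: the regularity (I.2.23) of the small part `Ã := θ_{k+1}A′^{(k),L^{−j}} + B̃^{(k),L^{−j}}` of the external field (2.93)

[cite: Balaban1982Higgs2]  T. Bałaban, Commun. Math. Phys. 86 (1982) 555–594.  p. 576 [PDF 22], verbatim: «We will need to apply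
Propositions I.2.1–I.2.3 to operators with external vector field equal to (2.93), so we have to verify the assumption of regularity
(I.2.23) for this field. From (2.90) and (2.91) it follows that
  |(∂_μ^{L^{−j}}(θ_{k+1}A′^{(k),L^{−j}} + B̃^{(k),L^{−j}}))(x)| ≦ O(1)(Lʲη)^{d/2}p(Lᵏε) ≦ O(1)p(Lʲε),   (2.94)
so the field Ã := θ_{k+1}A′^{(k),L^{−j}} + B̃^{(k),L^{−j}} satisfies this assumption.»  Inputs in print: (2.90) p. 575
«B̃^{(k)}(x) = O((Lᵏε)^κ) for every κ … and similar estimates for the derivative», (2.91) p. 575 «|θ_{k+1}A′^{(k)}(x)| ≦ O(1)p(Lᵏε),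
similarly for the derivative», η = L^{−k} (p. 576), p(ε) = b₀(1 + log ε⁻¹)^p ((2.2)–(2.3) p. 557, the tree's `B2.pFn`).

WHAT THIS MODULE ADDS (SKELETON row **B2.Eq2.87-2.98**, located member (2.94), in the SCHEMATIC POINTWISE currency of the row's
files of record `B2Eq289Decomposition` / `B2Eq293ExternalField` (p15 gen 5): points of `T_{L^{−j}}` after the rescaling, values in
a seminormed group, a lattice derivative = the difference of the two end values):
* `scale294_le` — the second inequality of (2.94): `(Lʲη)^{d/2}·p(Lᵏε) ≤ p(Lʲε)`, i.e. with `s := L^{k−j} ≥ 1`, `ℓ := Lʲε`,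
  `s·ℓ = Lᵏε ≤ 1`: `(s⁻¹)^{d/2}·p(s·ℓ) ≤ p(ℓ)` — the instance `q = d/2` of p15's `B2Eq293ExternalField.scale297_le`
  (`p` antitone on `(0,1]`, `B1Ineq352Proof.pFn_anti`);
* `ineq294_first` / `ineq294` — both printed inequalities of (2.94) at a point, from the DERIVATIVE CLAUSES of (2.90)/(2.91) in
  their rescaled printed shape (hypotheses `h291`, `h290`: the two derivatives are `≤ c·(Lʲη)^{d/2}p(Lᵏε)`) by the triangle inequality.

HONEST SCOPE.  Bookkeeping of the printed two-step estimate; the derivative clauses of (2.90)/(2.91) («similar estimates for the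
derivative») and the rescaling `η-lattice → L^{−j}-lattice` (the factor `(Lʲη)^{d/2}`) enter as hypotheses in printed shape, exactly
as Lemma 2.3's conclusions enter p15's `ineq298`; nothing of (2.90)/(2.91) is re-derived (row B2.Eq2.87-2.98 cites p270977 for them).
(2.92) (the determinant rewriting «omitting a numerical factor») stays un-typed.  Theorems only; no definition, no `Prop` fact.
-/
import Mathlib
import Literature.MathematicalPhysics.QuantumFieldTheory.Balaban1983to89.B2Eq293ExternalField

namespace Literature.MathematicalPhysics.QuantumFieldTheory.Balaban1983to89.B2Ineq294Regularity

open Literature.MathematicalPhysics.QuantumFieldTheory.Balaban1983to89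

/-! ## (2.94): the small part of the external field is regular

statement-level skeleton of published theorems with citation tags; proofs where landed; nothing here is a claim about the Yang–Mills mass gap -/

/-- **(2.94), second inequality** p. 576: `O(1)(Lʲη)^{d/2}p(Lᵏε) ≦ O(1)p(Lʲε)` — with `s ↤ L^{k−j} ≥ 1` (so `s⁻¹ = Lʲη`,
`η = L^{−k}`), `ℓ ↤ Lʲε`, `s·ℓ = Lᵏε ≤ 1`: `(s⁻¹)^{d/2}·p(s·ℓ) ≤ p(ℓ)`, because `Lʲη ≤ 1` and `p(·) = b₀(1 + log(·)⁻¹)^p` is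
antitone on `(0,1]`; the instance `q = d/2` of `B2Eq293ExternalField.scale297_le`. [cite: Balaban1982Higgs2, (2.94) p.576] -/
theorem scale294_le {b₀ p s ℓ : ℝ} (d : ℕ) (hb : 0 ≤ b₀) (hp : 0 ≤ p) (hℓ : 0 < ℓ) (hs : 1 ≤ s) (hsℓ : s * ℓ ≤ 1) :
    (s⁻¹) ^ ((d : ℝ) / 2) * B2.pFn b₀ p (s * ℓ) ≤ B2.pFn b₀ p ℓ :=
  B2Eq293ExternalField.scale297_le hb hp hℓ hs hsℓ (by positivity)

/-- **(2.94), first inequality** p. 576, at a point `x` and in a direction `μ`: if the lattice derivatives of the two summands obey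
the derivative clauses of (2.91) and (2.90) in rescaled form, `‖∂(θ_{k+1}A′^{(k),L^{−j}})(x)‖ ≤ c₁·(Lʲη)^{d/2}p(Lᵏε)` (`h291`) and
`‖∂B̃^{(k),L^{−j}}(x)‖ ≤ c₂·(Lʲη)^{d/2}p(Lᵏε)` (`h290`), then `‖∂(θ_{k+1}A′^{(k),L^{−j}} + B̃^{(k),L^{−j}})(x)‖ ≤ (c₁ + c₂)·(Lʲη)^{d/2}p(Lᵏε)`
(the lattice derivative is additive; `dA`, `dB` are the two derivatives, `w ↤ (Lʲη)^{d/2}p(Lᵏε)`).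
[cite: Balaban1982Higgs2, (2.94) p.576] -/
theorem ineq294_first {M : Type*} [SeminormedAddCommGroup M] {c₁ c₂ w : ℝ} {dA dB : M}
    (h291 : ‖dA‖ ≤ c₁ * w) (h290 : ‖dB‖ ≤ c₂ * w) : ‖dA + dB‖ ≤ (c₁ + c₂) * w :=
  calc ‖dA + dB‖ ≤ ‖dA‖ + ‖dB‖ := norm_add_le _ _
    _ ≤ c₁ * w + c₂ * w := add_le_add h291 h290
    _ = (c₁ + c₂) * w := by ring

/-- **(2.94)** p. 576 [PDF 22], verbatim: *"From (2.90) and (2.91) it follows that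
|(∂_μ^{L^{−j}}(θ_{k+1}A′^{(k),L^{−j}} + B̃^{(k),L^{−j}}))(x)| ≦ O(1)(Lʲη)^{d/2}p(Lᵏε) ≦ O(1)p(Lʲε), (2.94) so the field
Ã := θ_{k+1}A′^{(k),L^{−j}} + B̃^{(k),L^{−j}} satisfies this assumption"* (the regularity (I.2.23)).  Both inequalities at a point:
with `s ↤ L^{k−j} ≥ 1`, `ℓ ↤ Lʲε`, `s·ℓ = Lᵏε ≤ 1` (so `(s⁻¹)^{d/2} = (Lʲη)^{d/2}`), the derivative clauses of (2.91)/(2.90) in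
rescaled printed shape (`h291`, `h290`, constants `c₁, c₂ ≥ 0`) give `‖∂Ã(x)‖ ≤ (c₁ + c₂)·p(Lʲε)`.
[cite: Balaban1982Higgs2, (2.94) p.576] -/
theorem ineq294 {M : Type*} [SeminormedAddCommGroup M] {b₀ p s ℓ c₁ c₂ : ℝ} (d : ℕ) (hb : 0 ≤ b₀) (hp : 0 ≤ p)
    (hℓ : 0 < ℓ) (hs : 1 ≤ s) (hsℓ : s * ℓ ≤ 1) (hc₁ : 0 ≤ c₁) (hc₂ : 0 ≤ c₂) {dA dB : M}
    (h291 : ‖dA‖ ≤ c₁ * ((s⁻¹) ^ ((d : ℝ) / 2) * B2.pFn b₀ p (s * ℓ)))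
    (h290 : ‖dB‖ ≤ c₂ * ((s⁻¹) ^ ((d : ℝ) / 2) * B2.pFn b₀ p (s * ℓ))) :
    ‖dA + dB‖ ≤ (c₁ + c₂) * B2.pFn b₀ p ℓ :=
  (ineq294_first h291 h290).trans
    (mul_le_mul_of_nonneg_left (scale294_le d hb hp hℓ hs hsℓ) (add_nonneg hc₁ hc₂))

end Literature.MathematicalPhysics.QuantumFieldTheory.Balaban1983to89.B2Ineq294Regularity
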